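import Mathlib
import Summits.NavierStokesRegularity.NavierStokesRegularity.Theorems.ScenarioCensusPeriodicSlabSwirlFlux
import HarnessLib

/-!
# Census row S7 (c): the stream potential of a planar divergence-free field (homotopy formula)

Support file for the scenario census of `NavierStokesRegularity` (cell `pub/ns-census`, block S,
row S7 = Bang–Gui–Wang–Xie, J. Fluid Mech. 1005 (2025) A6 = arXiv:2205.13259, Thm 1.4; tree FACT
`Literature.Analysis.FluidPDE.BangGuiWangXie2025_periodicSlab_liouville`). Case (c) of the printed
theorem ("`r u^r` converges to `0` as `r → +∞`", §5 Step 3) bounds the cut-off pressure term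
`∫ P u^r φ_R'` through a Bogovskiĭ corrector `Ψ_R` with `div Ψ_R = r u^r` on the annular period
cell (printed Lemma 2.1). In the tree the corrector is built EXPLICITLY from the stream function
of the vertical period mean `g = ∫₀ᴸ U(· + s e₃) ds` of the velocity (a planar divergence-free
field). This file supplies the planar potential by the homotopy (Poincaré-lemma) formula

  `f(x) = ∫₀¹ ⟪J g(t x_h), x_h⟫ dt`,  `J = rotGen`, `x_h = horizPart x`,

and proves, for a `C¹` field `g` with bounded `g`, `Dg` and vanishing horizontal trace
`∂₀g₀ + ∂₁g₁ = 0`: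

* `hasFDerivAt_streamPotential` — `Df(x) v = ⟪J g(x_h), v⟫` (`∇f = J g`; differentiation under
  the integral, the symmetry `⟪J Dg v_h, x_h⟫ = ⟪J Dg x_h, v_h⟫` of trace-free horizontal blocks,
  and the fundamental theorem of calculus for `t ↦ t g(t x_h)`);
* `abs_streamPotential_sub_le_of_circle` — oscillation on circles: if `|⟪y_h, g y⟫| ≤ N` on the
  horizontal circle of radius `ρ = r(x) > 0`, then `|f(x) − f(ρ e₀)| ≤ π N` (polar angle via
  `Complex.arg`, angular path `θ ↦ f(R_θ (ρ e₀))` whose speed is the radial flux).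

Sequel: `…PeriodicSlabStreamCorrector` (the bounded corrector potential `f − f(√(1+r²) e₀)`).
No summit statement and no census row is proved in this file.

## References

* J. Bang, C. Gui, Y. Wang, C. Xie, arXiv:2205.13259, §5 Step 3 (proof of Thm 1.4 (c)) and
  Lemma 2.1 (the Bogovskiĭ map). [BangGuiWangXie2025]
-/

-- the summit and its single problem share the name (D-0017 nested layout)
set_option linter.dupNamespace false

noncomputable section

open MeasureTheory Set Function Filter InnerProductSpace
open scoped Topology RealInnerProductSpace Interval

namespace Summit.NavierStokesRegularity.NavierStokesRegularity.Theorems.ScenarioCensus.PeriodicSlab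

open Literature.Analysis Literature.Analysis.FluidPDE
/-! ### Plumbing for the generator `J = rotGen` -/

/-- `⟪J a, J x⟫ = ⟪x_h, a⟫`: the generator is an isometry on horizontal parts. -/
theorem inner_rotGen_rotGen (a x : EuclideanSpace ℝ (Fin 3)) :
    ⟪rotGen a, rotGen x⟫ = ⟪horizPart x, a⟫ := by
  rw [inner_rotGen_left, inner_horizPart_left]
  simp only [rotGen_apply_zero, rotGen_apply_one]
  ring

/-- `⟪J a, v_h⟫ = ⟪J a, v⟫`: the generator is horizontal. -/
theorem inner_rotGen_horizPart (a v : EuclideanSpace ℝ (Fin 3)) :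
    ⟪rotGen a, horizPart v⟫ = ⟪rotGen a, v⟫ := by
  rw [inner_rotGen_left, inner_rotGen_left, horizPart_apply_zero, horizPart_apply_one]

/-- `r(c e₀) = |c|`. -/
theorem cylRadius_smul_single_zero (c : ℝ) :
    cylRadius (c • EuclideanSpace.single 0 (1 : ℝ) : EuclideanSpace ℝ (Fin 3)) = |c| := by
  rw [cylRadius, ← Real.sqrt_sq_eq_abs]
  congr 1
  simp

/-- `J (x_h) = J x`. -/
theorem rotGen_horizPart (x : EuclideanSpace ℝ (Fin 3)) : rotGen (horizPart x) = rotGen x := by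
  ext i
  fin_cases i <;> simp [rotGen]

/-- The velocity of the rotation orbit is the generator at the current point:
`d/dθ R_θ x = J (R_θ x)`. -/
theorem hasDerivAt_rotZ_rotGen (x : EuclideanSpace ℝ (Fin 3)) (θ₀ : ℝ) :
    HasDerivAt (fun θ => rotZ θ x) (rotGen (rotZ θ₀ x)) θ₀ := by
  have h := hasDerivAt_rotZ x θ₀
  have e : -Real.sin θ₀ • (WithLp.toLp 2 ![x 0, x 1, 0] : EuclideanSpace ℝ (Fin 3)) +
      Real.cos θ₀ • rotGen x = rotGen (rotZ θ₀ x) := by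
    ext i
    fin_cases i <;> simp [rotGen] <;> ring
  rwa [e] at h

/-- **Symmetry of the planar pairing for trace-free horizontal blocks.** If the horizontal trace
of `G` vanishes, `G e₀ · e₀ + G e₁ · e₁ = 0`, then `⟪J (G v_h), x_h⟫ = ⟪J (G x_h), v_h⟫`
(closedness of the 1-form `⟪J g, dx⟫` for a planar divergence-free `g`). -/
theorem inner_rotGen_apply_horizPart_symm (G : EuclideanSpace ℝ (Fin 3) →L[ℝ] EuclideanSpace ℝ (Fin 3))
    (hG : G (EuclideanSpace.single 0 1) 0 + G (EuclideanSpace.single 1 1) 1 = 0)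
    (x v : EuclideanSpace ℝ (Fin 3)) :
    ⟪rotGen (G (horizPart v)), horizPart x⟫ = ⟪rotGen (G (horizPart x)), horizPart v⟫ := by
  have hv : horizPart v = v 0 • EuclideanSpace.single 0 (1 : ℝ) + v 1 • EuclideanSpace.single 1 (1 : ℝ) := by
    rw [horizPart_eq_toLp]; ext i; fin_cases i <;> simp
  have hx : horizPart x = x 0 • EuclideanSpace.single 0 (1 : ℝ) + x 1 • EuclideanSpace.single 1 (1 : ℝ) := by
    rw [horizPart_eq_toLp]; ext i; fin_cases i <;> simp
  rw [inner_rotGen_left, inner_rotGen_left]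
  conv_lhs => rw [hv]
  conv_rhs => rw [hx]
  rw [hx, hv]
  simp only [map_add, map_smul, PiLp.add_apply, PiLp.smul_apply, smul_eq_mul,
    PiLp.single_apply]
  simp only [Fin.isValue, ↓reduceIte, one_ne_zero, zero_ne_one, mul_one, mul_zero, add_zero, zero_add]
  linear_combination (x 1 * v 0 - x 0 * v 1) * hG

/-! ### The stream potential -/

/-- **The stream potential** of a planar field `g` (homotopy formula of the Poincaré lemma for
the closed 1-form `⟪J g, dx⟫`): `f(x) = ∫₀¹ ⟪J g(t x_h), x_h⟫ dt`. It depends on `x` only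
through `x_h`. -/
def streamPotential (g : EuclideanSpace ℝ (Fin 3) → EuclideanSpace ℝ (Fin 3))
    (x : EuclideanSpace ℝ (Fin 3)) : ℝ :=
  ∫ t in (0 : ℝ)..1, ⟪rotGen (g (t • horizPart x)), horizPart x⟫

/-- **The gradient of the stream potential is `J g`.** Let `g` be differentiable with
derivative `Dg`, `Dg` continuous, `‖g‖ ≤ G₀`, `‖Dg‖ ≤ K`, and with vanishing horizontal trace
`Dg(y) e₀ · e₀ + Dg(y) e₁ · e₁ = 0` at every point. Then `f = streamPotential g` has
`Df(x) v = ⟪J g(x_h), v⟫`. -/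
theorem hasFDerivAt_streamPotential {g : EuclideanSpace ℝ (Fin 3) → EuclideanSpace ℝ (Fin 3)}
    {Dg : EuclideanSpace ℝ (Fin 3) → (EuclideanSpace ℝ (Fin 3) →L[ℝ] EuclideanSpace ℝ (Fin 3))}
    (hg : ∀ y, HasFDerivAt g (Dg y) y) (hDgc : Continuous Dg) {G₀ K : ℝ}
    (hG₀ : ∀ y, ‖g y‖ ≤ G₀) (hK : ∀ y, ‖Dg y‖ ≤ K)
    (htr : ∀ y, Dg y (EuclideanSpace.single 0 1) 0 + Dg y (EuclideanSpace.single 1 1) 1 = 0)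
    (x₀ : EuclideanSpace ℝ (Fin 3)) :
    HasFDerivAt (streamPotential g) (innerSL ℝ (rotGen (g (horizPart x₀)))) x₀ := by
  have nrot : ∀ w : EuclideanSpace ℝ (Fin 3), ‖rotGen w‖ ≤ ‖w‖ := fun w => by
    have h1 : ‖rotGen w‖ ^ 2 ≤ ‖w‖ ^ 2 := by
      rw [EuclideanSpace.real_norm_sq_eq, EuclideanSpace.real_norm_sq_eq]
      simp only [Fin.sum_univ_three, rotGen_apply_zero, rotGen_apply_one, rotGen_apply_two]
      nlinarith [sq_nonneg (w 2)]
    exact (pow_le_pow_iff_left₀ (norm_nonneg _) (norm_nonneg _) two_ne_zero).1 h1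
  have ncyl : ∀ w : EuclideanSpace ℝ (Fin 3), cylRadius w ≤ ‖w‖ := fun w => by
    rw [← norm_horizPart]
    have h1 : ‖horizPart w‖ ^ 2 ≤ ‖w‖ ^ 2 := by
      rw [norm_horizPart_sq, EuclideanSpace.real_norm_sq_eq]
      simp only [Fin.sum_univ_three]
      nlinarith [sq_nonneg (w 2), Real.norm_eq_abs (w 2), sq_abs (w 2)]
    exact (pow_le_pow_iff_left₀ (norm_nonneg _) (norm_nonneg _) two_ne_zero).1 h1
  have hgc : Continuous g := continuous_iff_continuousAt.2 fun y => (hg y).continuousAt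
  have hG₀0 : 0 ≤ G₀ := (norm_nonneg _).trans (hG₀ 0)
  have hK0 : 0 ≤ K := (norm_nonneg _).trans (hK 0)
  -- the integrand and its derivative in `x`
  set F : EuclideanSpace ℝ (Fin 3) → ℝ → ℝ := fun x t => ⟪rotGen (g (t • horizPart x)), horizPart x⟫ with hF
  set F' : EuclideanSpace ℝ (Fin 3) → ℝ → (EuclideanSpace ℝ (Fin 3) →L[ℝ] ℝ) := fun x t =>
    (innerSL ℝ (horizPart x)).comp (rotGenL.comp ((t • Dg (t • horizPart x)).comp horizPart)) +
      innerSL ℝ (rotGen (g (t • horizPart x))) with hF'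
  have hF'_apply : ∀ x t v, F' x t v =
      t * ⟪rotGen (Dg (t • horizPart x) (horizPart v)), horizPart x⟫ +
        ⟪rotGen (g (t • horizPart x)), v⟫ := by
    intro x t v
    simp only [hF', _root_.add_apply, ContinuousLinearMap.comp_apply,
      innerSL_apply_apply, rotGenL_apply, FunLike.coe_smul, Pi.smul_apply, rotGen_smul,
      real_inner_comm (horizPart x)]
    rw [real_inner_smul_right]
  -- pointwise differentiability of the integrand
  have hdiff : ∀ t x, HasFDerivAt (fun y => F y t) (F' x t) x := by
    intro t x
    have h1 : HasFDerivAt (fun y : EuclideanSpace ℝ (Fin 3) => t • horizPart y) (t • horizPart) x :=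
      (horizPart.hasFDerivAt).const_smul t
    have h2 : HasFDerivAt (fun y => g (t • horizPart y)) ((Dg (t • horizPart x)).comp (t • horizPart)) x :=
      (hg (t • horizPart x)).comp x h1
    have h3 : HasFDerivAt (fun y => rotGen (g (t • horizPart y)))
        (rotGenL.comp ((Dg (t • horizPart x)).comp (t • horizPart))) x :=
      (hasFDerivAt_rotGen _).comp x h2
    refine (h3.inner ℝ (horizPart.hasFDerivAt (x := x))).congr_fderiv ?_
    ext v
    simp only [hF', fderivInnerCLM_apply, ContinuousLinearMap.comp_apply, ContinuousLinearMap.prod_apply,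
      _root_.add_apply, innerSL_apply_apply, rotGenL_apply, FunLike.coe_smul,
      Pi.smul_apply, map_smul, inner_rotGen_horizPart]
    rw [add_comm, real_inner_comm (horizPart x), real_inner_smul_right, smul_eq_mul]
  -- continuity in `t`
  have hline : ∀ x : EuclideanSpace ℝ (Fin 3), Continuous fun t : ℝ => t • horizPart x :=
    fun x => continuous_id.smul continuous_const
  have hFc : ∀ x, Continuous (F x) := fun x =>
    ((rotGenL.continuous.comp (hgc.comp (hline x)))).inner continuous_const
  have hF'c : ∀ x, Continuous (F' x) := by
    intro x
    refine Continuous.add ?_ ?_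
    · refine (continuous_const.clm_comp (continuous_const.clm_comp ?_))
      exact (continuous_id.smul (hDgc.comp (hline x))).clm_comp continuous_const
    · exact (innerSL ℝ).continuous.comp (rotGenL.continuous.comp (hgc.comp (hline x)))
  -- the bound on the ball of radius one
  have hbound : ∀ t ∈ Ι (0 : ℝ) 1, ∀ x ∈ Metric.ball x₀ 1, ‖F' x t‖ ≤ (‖x₀‖ + 1) * K + G₀ := by
    intro t ht x hx
    have ht' : 0 ≤ t ∧ t ≤ 1 := by
      rw [Set.uIoc_of_le zero_le_one] at ht; exact ⟨ht.1.le, ht.2⟩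
    have hxn : ‖x‖ ≤ ‖x₀‖ + 1 := by
      have := mem_ball_iff_norm.1 hx
      calc ‖x‖ = ‖(x - x₀) + x₀‖ := by rw [sub_add_cancel]
        _ ≤ ‖x - x₀‖ + ‖x₀‖ := norm_add_le _ _
        _ ≤ ‖x₀‖ + 1 := by linarith
    have hxh : ‖horizPart x‖ ≤ ‖x‖ := by
      rw [norm_horizPart]; exact ncyl x
    refine ContinuousLinearMap.opNorm_le_bound _ (by positivity) fun v => ?_
    rw [hF'_apply, Real.norm_eq_abs]
    have hvh : ‖horizPart v‖ ≤ ‖v‖ := by rw [norm_horizPart]; exact ncyl v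
    have e1 : |t * ⟪rotGen (Dg (t • horizPart x) (horizPart v)), horizPart x⟫| ≤ (‖x₀‖ + 1) * K * ‖v‖ := by
      rw [abs_mul, abs_of_nonneg ht'.1]
      have h1 : |⟪rotGen (Dg (t • horizPart x) (horizPart v)), horizPart x⟫| ≤ K * ‖v‖ * ‖x‖ := by
        calc |⟪rotGen (Dg (t • horizPart x) (horizPart v)), horizPart x⟫|
            ≤ ‖rotGen (Dg (t • horizPart x) (horizPart v))‖ * ‖horizPart x‖ := abs_real_inner_le_norm _ _
          _ ≤ ‖Dg (t • horizPart x) (horizPart v)‖ * ‖x‖ :=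
              mul_le_mul (nrot _) hxh (norm_nonneg _) (norm_nonneg _)
          _ ≤ (‖Dg (t • horizPart x)‖ * ‖horizPart v‖) * ‖x‖ :=
              mul_le_mul_of_nonneg_right (ContinuousLinearMap.le_opNorm _ _) (norm_nonneg _)
          _ ≤ (K * ‖v‖) * ‖x‖ := mul_le_mul_of_nonneg_right
              (mul_le_mul (hK _) hvh (norm_nonneg _) hK0) (norm_nonneg _)
      calc t * |⟪rotGen (Dg (t • horizPart x) (horizPart v)), horizPart x⟫| ≤ 1 * (K * ‖v‖ * ‖x‖) :=
            mul_le_mul ht'.2 h1 (abs_nonneg _) zero_le_one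
        _ ≤ (‖x₀‖ + 1) * K * ‖v‖ := by
            rw [one_mul]
            calc K * ‖v‖ * ‖x‖ ≤ K * ‖v‖ * (‖x₀‖ + 1) :=
                  mul_le_mul_of_nonneg_left hxn (mul_nonneg hK0 (norm_nonneg _))
              _ = (‖x₀‖ + 1) * K * ‖v‖ := by ring
    have e2 : |⟪rotGen (g (t • horizPart x)), v⟫| ≤ G₀ * ‖v‖ := by
      calc |⟪rotGen (g (t • horizPart x)), v⟫| ≤ ‖rotGen (g (t • horizPart x))‖ * ‖v‖ := abs_real_inner_le_norm _ _
        _ ≤ G₀ * ‖v‖ := mul_le_mul_of_nonneg_right ((nrot _).trans (hG₀ _)) (norm_nonneg _)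
    calc |t * ⟪rotGen (Dg (t • horizPart x) (horizPart v)), horizPart x⟫ + ⟪rotGen (g (t • horizPart x)), v⟫|
        ≤ |t * ⟪rotGen (Dg (t • horizPart x) (horizPart v)), horizPart x⟫| + |⟪rotGen (g (t • horizPart x)), v⟫| :=
          abs_add_le _ _
      _ ≤ (‖x₀‖ + 1) * K * ‖v‖ + G₀ * ‖v‖ := add_le_add e1 e2
      _ = ((‖x₀‖ + 1) * K + G₀) * ‖v‖ := by ring
  -- differentiation under the integral
  have hmain : HasFDerivAt (streamPotential g) (∫ t in (0 : ℝ)..1, F' x₀ t) x₀ := by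
    refine intervalIntegral.hasFDerivAt_integral_of_dominated_of_fderiv_le (𝕜 := ℝ) (μ := volume)
      (F := F) (F' := F') (x₀ := x₀) (s := Metric.ball x₀ 1) (bound := fun _ => (‖x₀‖ + 1) * K + G₀)
      (Metric.ball_mem_nhds x₀ one_pos) ?_ ?_ ?_ ?_ ?_ ?_
    · exact Eventually.of_forall fun x => (hFc x).aestronglyMeasurable
    · exact (hFc x₀).intervalIntegrable _ _
    · exact (hF'c x₀).aestronglyMeasurable
    · exact Eventually.of_forall fun t ht x hx => hbound t ht x hx
    · exact intervalIntegrable_const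
    · exact Eventually.of_forall fun t _ x _ => hdiff t x
  -- evaluation of the derivative: symmetry and the fundamental theorem of calculus
  have hint : IntervalIntegrable (F' x₀) volume 0 1 := (hF'c x₀).intervalIntegrable _ _
  have heval : (∫ t in (0 : ℝ)..1, F' x₀ t) = innerSL ℝ (rotGen (g (horizPart x₀))) := by
    ext v
    rw [ContinuousLinearMap.intervalIntegral_apply hint v, innerSL_apply_apply]
    -- the path `k(t) = t • g(t x_h)` and its derivative
    set xh := horizPart x₀ with hxh
    set k : ℝ → EuclideanSpace ℝ (Fin 3) := fun t => t • g (t • xh) with hk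
    set k' : ℝ → EuclideanSpace ℝ (Fin 3) := fun t => g (t • xh) + t • Dg (t • xh) xh with hk'
    have hkd : ∀ t, HasDerivAt k (k' t) t := by
      intro t
      have h1 : HasDerivAt (fun s : ℝ => s • xh) xh t := by
        simpa using (hasDerivAt_id t).smul_const xh
      have h2 : HasDerivAt (fun s : ℝ => g (s • xh)) (Dg (t • xh) xh) t :=
        (hg (t • xh)).comp_hasDerivAt t h1
      have h3 := (hasDerivAt_id' t).smul h2
      have h4 : k' t = t • Dg (t • xh) xh + (1 : ℝ) • g (t • xh) := by
        simp only [hk', one_smul, add_comm]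
      rw [h4]
      exact h3
    have hk'c : Continuous k' :=
      (hgc.comp (continuous_id.smul continuous_const)).add
        (continuous_id.smul ((hDgc.comp (continuous_id.smul continuous_const)).clm_apply continuous_const))
    have hftc : ∫ t in (0 : ℝ)..1, k' t = k 1 - k 0 :=
      intervalIntegral.integral_eq_sub_of_hasDerivAt (fun t _ => hkd t) (hk'c.intervalIntegrable _ _)
    have hk10 : k 1 - k 0 = g xh := by simp [hk]
    -- rewrite the integrand using the symmetry of the planar pairing
    have hsymm : ∀ t, F' x₀ t v = ⟪rotGen (k' t), v⟫ := by
      intro t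
      rw [hF'_apply, hk']
      have hs := inner_rotGen_apply_horizPart_symm (Dg (t • xh)) (htr _) x₀ v
      rw [← hxh] at hs
      rw [hs, inner_rotGen_horizPart, rotGen_add, rotGen_smul, inner_add_left, real_inner_smul_left]
      ring
    have hcont : Continuous fun t => ⟪rotGen (k' t), v⟫ :=
      (rotGenL.continuous.comp hk'c).inner continuous_const
    calc ∫ t in (0 : ℝ)..1, F' x₀ t v = ∫ t in (0 : ℝ)..1, ⟪rotGen (k' t), v⟫ :=
          intervalIntegral.integral_congr fun t _ => hsymm t
      _ = ⟪rotGen (∫ t in (0 : ℝ)..1, k' t), v⟫ := by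
          have hT : ∀ w, ((innerSL ℝ v).comp rotGenL) w = ⟪rotGen w, v⟫ := fun w => by
            rw [ContinuousLinearMap.comp_apply, rotGenL_apply, innerSL_apply_apply, real_inner_comm]
          rw [← hT, ← ((innerSL ℝ v).comp rotGenL).intervalIntegral_comp_comm (hk'c.intervalIntegrable _ _)]
          exact intervalIntegral.integral_congr fun t _ => (hT _).symm
      _ = ⟪rotGen (g xh), v⟫ := by rw [hftc, hk10]
  rwa [heval] at hmain

/-- `f = streamPotential g` is differentiable, with `Df(x) v = ⟪J g(x_h), v⟫`. -/
theorem fderiv_streamPotential {g : EuclideanSpace ℝ (Fin 3) → EuclideanSpace ℝ (Fin 3)}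
    {Dg : EuclideanSpace ℝ (Fin 3) → (EuclideanSpace ℝ (Fin 3) →L[ℝ] EuclideanSpace ℝ (Fin 3))}
    (hg : ∀ y, HasFDerivAt g (Dg y) y) (hDgc : Continuous Dg) {G₀ K : ℝ}
    (hG₀ : ∀ y, ‖g y‖ ≤ G₀) (hK : ∀ y, ‖Dg y‖ ≤ K)
    (htr : ∀ y, Dg y (EuclideanSpace.single 0 1) 0 + Dg y (EuclideanSpace.single 1 1) 1 = 0)
    (x v : EuclideanSpace ℝ (Fin 3)) :
    fderiv ℝ (streamPotential g) x v = ⟪rotGen (g (horizPart x)), v⟫ := by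
  rw [(hasFDerivAt_streamPotential hg hDgc hG₀ hK htr x).fderiv, innerSL_apply_apply]

/-- **Oscillation of the stream potential on circles.** Under the hypotheses of
`hasFDerivAt_streamPotential`, if `|⟪y_h, g y⟫| ≤ N` at every HORIZONTAL point `y` of the circle
of radius `ρ = r(x) > 0` (`y = y_h`, `r(y) = ρ`), then `|f(x) − f(ρ e₀)| ≤ π N`. -/
theorem abs_streamPotential_sub_le_of_circle {g : EuclideanSpace ℝ (Fin 3) → EuclideanSpace ℝ (Fin 3)}
    {Dg : EuclideanSpace ℝ (Fin 3) → (EuclideanSpace ℝ (Fin 3) →L[ℝ] EuclideanSpace ℝ (Fin 3))}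
    (hg : ∀ y, HasFDerivAt g (Dg y) y) (hDgc : Continuous Dg) {G₀ K : ℝ}
    (hG₀ : ∀ y, ‖g y‖ ≤ G₀) (hK : ∀ y, ‖Dg y‖ ≤ K)
    (htr : ∀ y, Dg y (EuclideanSpace.single 0 1) 0 + Dg y (EuclideanSpace.single 1 1) 1 = 0)
    {x : EuclideanSpace ℝ (Fin 3)} (hx : 0 < cylRadius x) {N : ℝ}
    (hN : ∀ y : EuclideanSpace ℝ (Fin 3), horizPart y = y → cylRadius y = cylRadius x →
      |⟪horizPart y, g y⟫| ≤ N) :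
    |streamPotential g x - streamPotential g (cylRadius x • EuclideanSpace.single 0 1)| ≤ Real.pi * N := by
  set ρ := cylRadius x with hρ
  set e₀ : EuclideanSpace ℝ (Fin 3) := EuclideanSpace.single 0 1 with he₀
  set p : EuclideanSpace ℝ (Fin 3) := ρ • e₀ with hp
  set f := streamPotential g with hf
  have hN0 : 0 ≤ N := by
    have h := hN p ?_ ?_
    · exact (abs_nonneg _).trans h
    · rw [hp, map_smul]; congr 1; rw [he₀, horizPart_eq_toLp]; ext i; fin_cases i <;> simp
    · rw [hp, he₀, cylRadius_smul_single_zero, abs_of_pos hx]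
  -- the polar angle of `x_h`
  set z : ℂ := ⟨x 0, x 1⟩ with hz
  have hzn : ‖z‖ = ρ := by
    rw [hρ, cylRadius, Complex.norm_def, Complex.normSq_apply]
    congr 1; simp [hz]; ring
  have hz0 : z ≠ 0 := by
    intro h; rw [h, norm_zero] at hzn; exact absurd hzn.symm hx.ne'
  set θ : ℝ := Complex.arg z with hθ
  have hcos : ρ * Real.cos θ = x 0 := by
    rw [hθ, Complex.cos_arg hz0, hzn]; field_simp [hx.ne']; simp [hz]
  have hsin : ρ * Real.sin θ = x 1 := by
    rw [hθ, Complex.sin_arg, hzn]; field_simp [hx.ne']; simp [hz]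
  have hθπ : |θ| ≤ Real.pi := Complex.abs_arg_le_pi z
  have hrot : rotZ θ p = horizPart x := by
    rw [horizPart_eq_toLp]
    ext i
    fin_cases i <;> simp [rotZ, hp, he₀] <;> linarith [hcos, hsin]
  -- `f` only sees the horizontal part
  have hfh : ∀ y, f (horizPart y) = f y := fun y => by
    simp only [hf, streamPotential, horizPart_horizPart]
  -- the angular path
  set h : ℝ → ℝ := fun s => f (rotZ s p) with hh
  have hfd : ∀ y, HasFDerivAt f (innerSL ℝ (rotGen (g (horizPart y)))) y :=
    hasFDerivAt_streamPotential hg hDgc hG₀ hK htr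
  have hhd : ∀ s, HasDerivAt h ⟪horizPart (rotZ s p), g (rotZ s p)⟫ s := by
    intro s
    have h1 := (hfd (rotZ s p)).comp_hasDerivAt s (hasDerivAt_rotZ_rotGen p s)
    have hph : horizPart (rotZ s p) = rotZ s p := by
      rw [horizPart_eq_toLp]; ext i; fin_cases i <;> simp [rotZ, hp, he₀]
    have e : innerSL ℝ (rotGen (g (horizPart (rotZ s p)))) (rotGen (rotZ s p)) =
        ⟪horizPart (rotZ s p), g (rotZ s p)⟫ := by
      rw [innerSL_apply_apply, inner_rotGen_rotGen, hph]
    rw [e] at h1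
    exact h1
  have hderiv_le : ∀ s, ‖deriv h s‖ ≤ N := by
    intro s
    rw [(hhd s).deriv, Real.norm_eq_abs]
    refine hN (rotZ s p) ?_ ?_
    · rw [horizPart_eq_toLp]; ext i; fin_cases i <;> simp [rotZ, hp, he₀]
    · rw [cylRadius_rotZ, hp, he₀, cylRadius_smul_single_zero, abs_of_pos hx]
  have hmv : ‖h θ - h 0‖ ≤ N * ‖θ - 0‖ :=
    (convex_univ).norm_image_sub_le_of_norm_deriv_le (fun s _ => (hhd s).differentiableAt)
      (fun s _ => hderiv_le s) (mem_univ 0) (mem_univ θ)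
  rw [sub_zero, Real.norm_eq_abs, Real.norm_eq_abs] at hmv
  have hh0 : h 0 = f p := by simp [hh]
  have hhθ : h θ = f x := by
    show f (rotZ θ p) = f x
    rw [hrot, hfh]
  rw [hhθ, hh0] at hmv
  calc |f x - f p| ≤ N * |θ| := hmv
    _ ≤ N * Real.pi := mul_le_mul_of_nonneg_left hθπ hN0
    _ = Real.pi * N := mul_comm _ _

end Summit.NavierStokesRegularity.NavierStokesRegularity.Theorems.ScenarioCensus.PeriodicSlab

end
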